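import Mathlib
import Summits.ValiantsHypothesis.ValiantsHypothesis.Theorems.ValuativeGCTValuativeFlipProtoHwv
import Literature.Computability.Complexity.OccurrenceObstructionsBIP

/-!
# Explicit two-row highest-weight vectors, II: inheritance to `ℂ[Sym^m ℂ^{m×m}]` and the diagonal
# pencil of the padded permanent (crux `ValuativeGCT.ValuativeFlip`, stmt-ValiantsHypothesis-12624;
# wall-breaker axis k13 "explicit padded-permanent highest-weight vectors for seedRichness", part D)

* `twoRowHWV m hm j = F_j`: the protomorph highest-weight vector `P_j` of `ℂ[Sym^m ℂ²]` (part C) renamed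
  along the last two letters `(m-1, m-2) < (m-1, m-1)` of `MatIdx m` (`lastTwo`); a highest-weight vector
  of `ℂ[Sym^m ℂ^{m×m}]` for the upper triangular Borel of `GL_{m²}` of weight `twoRowWeight m hm j` — the
  dual of the two-row partition `((j+1)m - j, j)` on the greatest positions
  (`twoRowHWV_mem_highestWeightSpace`, by the tree's inheritance `rename_mem_highestWeightSpace_coordRep`);
  its value at a form `q` is the `j`-th protomorph of `q` restricted to the last two letters
  (`aeval_formCoeff_twoRowHWV`).
* the SINGULAR pencil matrix `A(a)` (`pencilMat`), `a : block → ℂ`: its last two rows send the letter `s`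
  to the identity of the `n × n` block and `t` to `diag(a)` on the block plus the padding variable, so
  that `A(a) · X₀₀^{m-n} per_n` restricted to `(s, t)` is the diagonal pencil `t^{m-n} ∏_i (a_i t + s)`
  (`killCompl_linSubst_pencilMat_paddedPerFormLex`: the permanent of a diagonal matrix of linear forms —
  every binary `n`-ic splits, so these pencils are Zariski dense in the two-row restriction variety of the
  padded permanent);
* the coefficients of such pencils are elementary symmetric polynomials (`bcoeff_pencilForm`), whence the
  value polynomials `G_j = pencilValue n m j ∈ ℂ[Z_block]` (protomorphs of the generic pencil) with
  `F_j(A(a) · pp) = G_j(a)` (`aeval_formCoeff_pencil_twoRowHWV`).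

Sources: folklore; BLMW 2011 §5.2 (conventions); Mulmuley–Sohoni 2001 §4 (`End · f ⊆ Δ(f)`).
-/

set_option linter.dupNamespace false

namespace Summit.ValiantsHypothesis.ValiantsHypothesis.Theorems.ValuativeFlip

open MvPolynomial
open scoped BigOperators

noncomputable section

/-! ## Part D — inheritance to the last two letters, the diagonal pencil of the padded permanent, and
algebraic independence of the explicit two-row highest-weight vectors -/

section TwoRow

open Literature.NumberTheory.DiophantineGeometry Literature.Computability.AlgebraicComplexity
  Literature.Barriers.ValiantsHypothesis Literature.Computability.Complexity

variable {m : ℕ}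

/-! ### The last two letters `(m-1, m-2) < (m-1, m-1)` of `MatIdx m` -/

/-- The last two letters of the lexicographically ordered matrix positions: `a ↦ (m-1, m-2+a)`.
[folklore] -/
def lastTwo (hm : 2 ≤ m) (a : Fin 2) : MatIdx m :=
  lastRow ⟨m - 2 + a, by have := a.2; omega⟩

/-- `lastTwo` is strictly monotone. [folklore] -/
theorem lastTwo_strictMono (hm : 2 ≤ m) : StrictMono (lastTwo hm) := by
  intro a b hab
  apply lastRow_strictMono
  rw [Fin.lt_def]
  have : (a : ℕ) < b := hab
  simpa using this

/-- The last two letters form an upper set. [folklore] -/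
theorem isUpperSet_range_lastTwo (hm : 2 ≤ m) : IsUpperSet (Set.range (lastTwo hm)) := by
  rintro x y hxy ⟨a, rfl⟩
  have hy : y ∈ Set.range (lastRow (m := m)) := isUpperSet_range_lastRow hxy ⟨_, rfl⟩
  obtain ⟨j, rfl⟩ := hy
  have hj : m - 2 + (a : ℕ) ≤ (j : ℕ) := by
    have h := (lastRow_strictMono (m := m)).le_iff_le.mp hxy
    exact h
  have hj2 := j.2
  refine ⟨⟨(j : ℕ) - (m - 2), by omega⟩, ?_⟩
  simp only [lastTwo]
  congr 1
  exact Fin.ext (by simp; omega)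

/-! ### The two-row highest-weight vectors of `ℂ[Sym^m ℂ^{m×m}]` -/

/-- **The explicit two-row highest-weight vectors** `F_j` of `ℂ[Sym^m ℂ^{m×m}]`: the protomorph `P_j`
of the binary form in the last two letters, i.e. `P_j` renamed along `lastTwo`.  Its value at a form
`q` is the `j`-th protomorph of the restriction of `q` to the last two letters
(`aeval_formCoeff_twoRowHWV`). [folklore] -/
def twoRowHWV (m : ℕ) (hm : 2 ≤ m) (j : ℕ) : MvPolynomial (DegIdx (MatIdx m) m) ℂ :=
  rename (degIdxMap (lastTwo_strictMono hm).injective) (protoHWV m j)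

/-- The weight of `F_j`: `protoWeight m j` on the last two letters, zero elsewhere (the dual of the
two-row partition `((j+1)m - j, j)` placed on the greatest positions). [folklore] -/
def twoRowWeight (m : ℕ) (hm : 2 ≤ m) (j : ℕ) : Weight (MatIdx m) :=
  Function.extend (lastTwo hm) (protoWeight m j) 0

/-- **`F_j` is a highest-weight vector of `ℂ[Sym^m ℂ^{m×m}]`** of weight `twoRowWeight m hm j`
(inheritance `rename_mem_highestWeightSpace_coordRep` of `protoHWV_mem_highestWeightSpace`).
[folklore] -/
theorem twoRowHWV_mem_highestWeightSpace (hm : 2 ≤ m) {j : ℕ} (hj : j ≤ m) :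
    twoRowHWV m hm j ∈ highestWeightSpace (coordRep (MatIdx m) ℂ m) (twoRowWeight m hm j) :=
  rename_mem_highestWeightSpace_coordRep (lastTwo_strictMono hm) (isUpperSet_range_lastTwo hm)
    (protoHWV_mem_highestWeightSpace (by omega) hj)

/-- `killCompl` preserves forms of degree `m`. [folklore] -/
theorem isHomogeneous_killCompl {σ τ : Type*} {ι : σ → τ} (hι : Function.Injective ι)
    {q : MvPolynomial τ ℂ} {n : ℕ} (hq : q.IsHomogeneous n) : (killCompl hι q).IsHomogeneous n := by
  classical
  have h := hq.aeval (fun i : τ => if h : i ∈ Set.range ι then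
      (X ((Equiv.ofInjective ι hι).symm ⟨i, h⟩) : MvPolynomial σ ℂ) else 0) (n := 1) (fun i => by
    split_ifs
    · exact isHomogeneous_X ℂ _
    · exact isHomogeneous_zero σ ℂ 1)
  rw [one_mul] at h
  exact h

/-- **Values of `F_j`**: at a form `q` of degree `m`, `F_j(q) = P_j(q|_{last two letters})`.
[folklore] -/
theorem aeval_formCoeff_twoRowHWV (hm : 2 ≤ m) (j : ℕ) {q : MvPolynomial (MatIdx m) ℂ}
    (hq : q.IsHomogeneous m) :
    aeval (formCoeff m q) (twoRowHWV m hm j) =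
      bcoeff m j (proto m (killCompl (lastTwo_strictMono hm).injective q)) := by
  rw [twoRowHWV, aeval_rename, ← aeval_formCoeff_protoHWV (isHomogeneous_killCompl _ hq)]
  refine congrArg (fun p : DegIdx (Fin 2) m → ℂ => aeval p (protoHWV m j)) (funext fun d => ?_)
  rw [Function.comp_apply, formCoeff_apply, formCoeff_apply, degIdxMap_val, coeff_killCompl]

/-- Restricting a linear substitution instance `A · p` to the letters `ι`: substitute for `x` the
linear form `∑_i A_{ι i, x} y_i`. [folklore] -/
theorem killCompl_linSubst_eq_aeval {σ τ : Type*} [Fintype σ] [Fintype τ] {ι : σ → τ}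
    (hι : Function.Injective ι) (A : Matrix τ τ ℂ) (p : MvPolynomial τ ℂ) :
    killCompl hι (linSubst τ ℂ A p) = aeval (fun x => ∑ i : σ, A (ι i) x • (X i : MvPolynomial σ ℂ)) p := by
  rw [linSubst, comp_aeval_apply]
  refine congrArg (fun f : τ → MvPolynomial σ ℂ => aeval f p) (funext fun x => ?_)
  rw [map_sum, sum_eq_sum_app hι _ fun y hy => by rw [map_smul, killCompl_X_of_not_mem hι hy, smul_zero]]
  exact Finset.sum_congr rfl fun i _ => by rw [map_smul, killCompl_X_app]

/-! ### The diagonal pencil `t^{m-n} ∏_i (s + a_i t)` of the padded permanent -/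

variable {n : ℕ}

/-- The diagonal letters `(i, i)` of the bottom-right `n × n` block. [folklore] -/
def blockDiag (n m : ℕ) (i : BlockIdx n m) : MatIdx m :=
  toLex ((i : Fin m), (i : Fin m))

/-- `blockDiag` is injective. [folklore] -/
theorem blockDiag_injective (n m : ℕ) : Function.Injective (blockDiag n m) := by
  intro i j h
  have := congrArg (fun x => (ofLex x).1) h
  exact Subtype.ext this

/-- The block letter `(i, j)` is diagonal only if `i = j`. [folklore] -/
theorem toLex_mem_range_blockDiag_iff (i j : BlockIdx n m) :
    (toLex ((i : Fin m), (j : Fin m)) : MatIdx m) ∈ Set.range (blockDiag n m) ↔ i = j := by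
  constructor
  · rintro ⟨l, hl⟩
    have h1 := congrArg (fun x => (ofLex x).1) hl
    have h2 := congrArg (fun x => (ofLex x).2) hl
    simp only [blockDiag, ofLex_toLex] at h1 h2
    exact Subtype.ext (h1.symm.trans h2)
  · rintro rfl
    exact ⟨i, rfl⟩

/-- Row `(m-1, m-2)` of the pencil matrix: `1` on the diagonal block letters, `0` elsewhere (the
letter `s` goes to the identity of the block). [folklore] -/
def pencilRow₀ (n m : ℕ) : MatIdx m → ℂ :=
  Function.extend (blockDiag n m) (fun _ => 1) 0

/-- Row `(m-1, m-1)` of the pencil matrix: `a_i` on the diagonal block letter `(i, i)`, `1` on the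
padding letter `(0, 0)` (when it is not a block letter), `0` elsewhere (the letter `t` goes to
`t · diag(a)` on the block and to the padding variable). [folklore] -/
def pencilRow₁ [NeZero m] (a : BlockIdx n m → ℂ) : MatIdx m → ℂ :=
  Function.extend (blockDiag n m) a fun x => if x = toLex ((0 : Fin m), (0 : Fin m)) then 1 else 0

/-- **The pencil matrix** `A(a)`: its last two rows are `pencilRow₀`, `pencilRow₁ a`, all other rows
vanish (a SINGULAR matrix; `A(a) · (X₀₀^{m-n} per_n)` restricted to the last two letters is the
diagonal pencil `t^{m-n} ∏_i (s + a_i t)`). [folklore] -/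
def pencilMat [NeZero m] (hm : 2 ≤ m) (a : BlockIdx n m → ℂ) : Matrix (MatIdx m) (MatIdx m) ℂ :=
  Matrix.of fun y x => if y = lastTwo hm 0 then pencilRow₀ n m x
    else if y = lastTwo hm 1 then pencilRow₁ a x else 0

/-- Substituting into the generic permanent gives the permanent of the substituted matrix.
[folklore] -/
theorem aeval_perPoly {ι S : Type*} [Fintype ι] [DecidableEq ι] [CommRing S] [Algebra ℂ S]
    (g : ι × ι → S) : aeval g (perPoly ι ℂ) = (Matrix.of fun i j => g (i, j)).permanent := by
  simp [perPoly, Matrix.permanent, map_sum, map_prod, Matrix.mvPolynomialX_apply]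

/-- Ring homomorphisms commute with permanents. [folklore] -/
theorem ringHom_map_permanent {ι S T : Type*} [Fintype ι] [DecidableEq ι] [CommRing S] [CommRing T]
    (f : S →+* T) (M : Matrix ι ι S) : f M.permanent = (M.map f).permanent := by
  simp [Matrix.permanent, map_sum, map_prod]

/-- The linear forms substituted by the pencil: `x ↦ pencilRow₀ x · s + pencilRow₁ a x · t`.
[folklore] -/
theorem pencil_subst_blockLetter [NeZero m] (a : BlockIdx n m → ℂ) (i j : BlockIdx n m) :
    pencilRow₀ n m (toLex ((i : Fin m), (j : Fin m))) • (X 0 : MvPolynomial (Fin 2) ℂ) +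
        pencilRow₁ a (toLex ((i : Fin m), (j : Fin m))) • (X 1 : MvPolynomial (Fin 2) ℂ) =
      Matrix.diagonal (fun i => C (a i) * X 1 + X 0) i j := by
  by_cases hij : i = j
  · subst hij
    have h0 : pencilRow₀ n m (toLex ((i : Fin m), (i : Fin m))) = 1 :=
      (blockDiag_injective n m).extend_apply _ _ i
    have h1 : pencilRow₁ a (toLex ((i : Fin m), (i : Fin m))) = a i :=
      (blockDiag_injective n m).extend_apply _ _ i
    rw [h0, h1, Matrix.diagonal_apply_eq, one_smul, smul_eq_C_mul, add_comm]
  · have hnot : (toLex ((i : Fin m), (j : Fin m)) : MatIdx m) ∉ Set.range (blockDiag n m) :=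
      fun h => hij ((toLex_mem_range_blockDiag_iff i j).mp h)
    have h0 : pencilRow₀ n m (toLex ((i : Fin m), (j : Fin m))) = 0 := by
      rw [pencilRow₀, Function.extend_apply' _ _ _ (fun ⟨l, hl⟩ => hnot ⟨l, hl⟩)]
      rfl
    have h1 : pencilRow₁ a (toLex ((i : Fin m), (j : Fin m))) = 0 := by
      rw [pencilRow₁, Function.extend_apply' _ _ _ (fun ⟨l, hl⟩ => hnot ⟨l, hl⟩), if_neg]
      intro h
      apply hij
      have h1 := congrArg (fun x => ((ofLex x).1 : Fin m)) h
      have h2 := congrArg (fun x => ((ofLex x).2 : Fin m)) h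
      simp only [ofLex_toLex] at h1 h2
      exact Subtype.ext (Fin.ext (by rw [h1, ← h2]))
    rw [h0, h1, zero_smul, zero_smul, add_zero, Matrix.diagonal_apply_ne _ hij]

/-- The padding letter `(0,0)` goes to `t` when there is padding (`n < m`). [folklore] -/
theorem pencil_subst_zero [NeZero m] (hnm : n < m) (a : BlockIdx n m → ℂ) :
    pencilRow₀ n m (toLex ((0 : Fin m), (0 : Fin m))) • (X 0 : MvPolynomial (Fin 2) ℂ) +
        pencilRow₁ a (toLex ((0 : Fin m), (0 : Fin m))) • (X 1 : MvPolynomial (Fin 2) ℂ) = X 1 := by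
  have hnot : (toLex ((0 : Fin m), (0 : Fin m)) : MatIdx m) ∉ Set.range (blockDiag n m) := by
    rintro ⟨l, hl⟩
    have h1 := congrArg (fun x => ((ofLex x).1 : ℕ)) hl
    simp only [blockDiag, ofLex_toLex, Fin.val_zero] at h1
    have := l.2
    omega
  have h0 : pencilRow₀ n m (toLex ((0 : Fin m), (0 : Fin m))) = 0 := by
    rw [pencilRow₀, Function.extend_apply' _ _ _ (fun ⟨l, hl⟩ => hnot ⟨l, hl⟩)]
    rfl
  have h1 : pencilRow₁ a (toLex ((0 : Fin m), (0 : Fin m))) = 1 := by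
    rw [pencilRow₁, Function.extend_apply' _ _ _ (fun ⟨l, hl⟩ => hnot ⟨l, hl⟩), if_pos rfl]
  rw [h0, h1, zero_smul, one_smul, zero_add]

/-- **The padded permanent along the pencil**: restricted to the last two letters `(s, t)`,
`A(a) · (X₀₀^{m-n} per_n) = t^{m-n} · ∏_i (a_i t + s)` (the permanent of a diagonal matrix of linear
forms). [folklore] -/
theorem killCompl_linSubst_pencilMat_paddedPerFormLex [NeZero m] (hnm : n ≤ m) (hm : 2 ≤ m)
    (a : BlockIdx n m → ℂ) :
    killCompl (lastTwo_strictMono hm).injective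
        (linSubst (MatIdx m) ℂ (pencilMat hm a) (paddedPerFormLex ℂ n m)) =
      X 1 ^ (m - n) * ∏ i : BlockIdx n m, (C (a i) * X 1 + X 0) := by
  classical
  have hne : lastTwo hm 1 ≠ lastTwo hm 0 := fun h =>
    absurd ((lastTwo_strictMono hm).injective h) (by decide)
  have hsubst : (fun x : MatIdx m => ∑ i : Fin 2, pencilMat hm a (lastTwo hm i) x •
      (X i : MvPolynomial (Fin 2) ℂ)) =
      fun x => pencilRow₀ n m x • (X 0 : MvPolynomial (Fin 2) ℂ) + pencilRow₁ a x • X 1 := by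
    funext x
    rw [Fin.sum_univ_two, pencilMat, Matrix.of_apply, Matrix.of_apply, if_pos rfl, if_neg hne, if_pos rfl]
  rw [killCompl_linSubst_eq_aeval, hsubst, paddedPerFormLex_eq, map_mul, map_pow, aeval_X, aeval_rename,
    aeval_perPoly]
  congr 1
  · -- the padding factor
    rcases Nat.eq_or_lt_of_le hnm with h | h
    · have h0 : m - n = 0 := by omega
      rw [h0, pow_zero, pow_zero]
    · rw [pencil_subst_zero h]
  · -- the block: a diagonal matrix of linear forms
    have hmat : (Matrix.of fun i j : BlockIdx n m =>
        ((fun x : MatIdx m => pencilRow₀ n m x • (X 0 : MvPolynomial (Fin 2) ℂ) + pencilRow₁ a x • X 1) ∘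
          fun ij : BlockIdx n m × BlockIdx n m => (toLex ((ij.1 : Fin m), (ij.2 : Fin m)) : MatIdx m)) (i, j)) =
        Matrix.diagonal fun i => C (a i) * X 1 + X 0 := by
      refine Matrix.ext fun i j => ?_
      rw [Matrix.of_apply, Function.comp_apply]
      exact pencil_subst_blockLetter a i j
    rw [hmat, Matrix.permanent_diagonal]

/-- **Coefficients of the diagonal pencil are elementary symmetric polynomials**: for any
`c : ι → S`, the coefficient of `s^j t^{m-j}` in `t^{m-n} ∏_i (c_i t + s)` (`n = |ι| ≤ m`) is
`e_{n-j}(c) = ∑_{|T| = n-j} ∏_{i ∈ T} c_i` for `j ≤ n` and `0` for `n < j ≤ m`. [folklore] -/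
theorem bcoeff_pencilForm {ι S : Type*} [Fintype ι] [DecidableEq ι] [CommRing S] (c : ι → S)
    (hnm : Fintype.card ι ≤ m) (j : ℕ) :
    bcoeff m j (X 1 ^ (m - Fintype.card ι) * ∏ i, (C (c i) * X 1 + X 0) : MvPolynomial (Fin 2) S) =
      if j ≤ Fintype.card ι then
        ∑ T ∈ Finset.powersetCard (Fintype.card ι - j) Finset.univ, ∏ i ∈ T, c i else 0 := by
  set n := Fintype.card ι with hn
  rw [Finset.prod_add, Finset.mul_sum, bcoeff, coeff_sum]
  have hterm : ∀ T ∈ (Finset.univ : Finset ι).powerset,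
      coeff (bexp m j) (X 1 ^ (m - n) * ((∏ i ∈ T, C (c i) * X 1) * ∏ i ∈ Finset.univ \ T, X 0) :
        MvPolynomial (Fin 2) S) = if T.card = n - j ∧ j ≤ n then ∏ i ∈ T, c i else 0 := by
    intro T _
    have hTn : T.card ≤ n := by rw [hn, ← Finset.card_univ]; exact Finset.card_le_card (Finset.subset_univ T)
    have hform : (X 1 ^ (m - n) * ((∏ i ∈ T, C (c i) * X 1) * ∏ i ∈ Finset.univ \ T, X 0) :
        MvPolynomial (Fin 2) S) = C (∏ i ∈ T, c i) * X 0 ^ (n - T.card) * X 1 ^ (m - (n - T.card)) := by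
      rw [Finset.prod_mul_distrib, Finset.prod_const, Finset.prod_const, Finset.card_sdiff_of_subset
        (Finset.subset_univ T), Finset.card_univ, ← hn, map_prod]
      have : m - (n - T.card) = (m - n) + T.card := by omega
      rw [this, pow_add]
      ring
    rw [hform, coeff_bexp_C_mul_X_pow_mul_X_pow (m := m) (by omega)]
    by_cases h : T.card = n - j ∧ j ≤ n
    · rw [if_pos (by omega), if_pos h]
    · rw [if_neg (by omega), if_neg h]
  rw [Finset.sum_congr rfl hterm]
  by_cases hjn : j ≤ n
  · rw [if_pos hjn, ← Finset.sum_filter]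
    congr 1
    ext T
    simp [Finset.mem_powersetCard, hjn]
  · rw [if_neg hjn]
    exact Finset.sum_eq_zero fun T _ => if_neg fun h => hjn h.2

/-! ### The generic pencil over `ℂ[Z_i : i ∈ block]` and the value polynomials `G_j` -/

/-- The generic diagonal pencil form `t^{m-n} ∏_i (Z_i t + s)` over `ℂ[Z]`. [folklore] -/
def genericPencilForm (n m : ℕ) : MvPolynomial (Fin 2) (MvPolynomial (BlockIdx n m) ℂ) :=
  X 1 ^ (m - n) * ∏ i : BlockIdx n m, (C (X i) * X 1 + X 0)

/-- **The value polynomials** `G_j(Z) = P_j(t^{m-n} ∏_i (Z_i t + s)) ∈ ℂ[Z]`: the `j`-th protomorph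
of the generic pencil form. [folklore] -/
def pencilValue (n m : ℕ) (j : ℕ) : MvPolynomial (BlockIdx n m) ℂ :=
  bcoeff m j (proto m (genericPencilForm n m))

/-- The generic pencil form is homogeneous of degree `m` (`n ≤ m`). [folklore] -/
theorem isHomogeneous_genericPencilForm (hnm : n ≤ m) : (genericPencilForm n m).IsHomogeneous m := by
  rw [genericPencilForm]
  have h1 : ∀ i : BlockIdx n m, (C (X i) * X 1 + X 0 :
      MvPolynomial (Fin 2) (MvPolynomial (BlockIdx n m) ℂ)).IsHomogeneous 1 := fun i => by
    have h := ((isHomogeneous_C (Fin 2) (X i : MvPolynomial (BlockIdx n m) ℂ)).mul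
      (isHomogeneous_X _ 1)).add (isHomogeneous_X _ 0)
    rwa [zero_add] at h
  have h := (isHomogeneous_X_pow (R := MvPolynomial (BlockIdx n m) ℂ) (1 : Fin 2) (m - n)).mul
    (IsHomogeneous.prod Finset.univ _ (fun _ => 1) fun i _ => h1 i)
  rwa [Finset.sum_const, Finset.card_univ, smul_eq_mul, mul_one, card_blockIdx hnm,
    Nat.sub_add_cancel hnm] at h

/-- Specialising the generic pencil form at `a` gives the pencil form of `a`. [folklore] -/
theorem map_eval_genericPencilForm (a : BlockIdx n m → ℂ) :
    map (eval a) (genericPencilForm n m) = X 1 ^ (m - n) * ∏ i : BlockIdx n m, (C (a i) * X 1 + X 0) := by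
  rw [genericPencilForm, map_mul, map_pow, map_X, map_prod]
  refine congrArg _ (Finset.prod_congr rfl fun i _ => ?_)
  rw [map_add, map_mul, map_C, map_X, map_X, eval_X]

/-- **The values of the two-row highest-weight vectors along the pencil are the value polynomials**:
`F_j(A(a) · X₀₀^{m-n} per_n) = G_j(a)`. [folklore] -/
theorem aeval_formCoeff_pencil_twoRowHWV {n m : ℕ} [NeZero m] (hnm : n ≤ m) (hm : 2 ≤ m) (j : ℕ)
    (a : BlockIdx n m → ℂ) :
    aeval (formCoeff m (linSubst (MatIdx m) ℂ (pencilMat hm a) (paddedPerFormLex ℂ n m))) (twoRowHWV m hm j) = eval a (pencilValue n m j) := by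
  rw [aeval_formCoeff_twoRowHWV hm j (linSubst_isHomogeneous _ (paddedPerFormLex_isHomogeneous ℂ hnm)),
    killCompl_linSubst_pencilMat_paddedPerFormLex hnm hm, pencilValue, bcoeff, bcoeff, ← coeff_map,
    map_proto, map_eval_genericPencilForm]

end TwoRow

end

end Summit.ValiantsHypothesis.ValiantsHypothesis.Theorems.ValuativeFlip
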